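import Literature.NumberTheory.EllipticCurves.PadicSigmaSqMinusTwistUniquenessProofs
import HarnessLib

/-!
# `ℓ`-adic sizes of denominators, and `log₂` of rationals of equal odd size (proofs only)

Topic `Literature/NumberTheory/EllipticCurves` (trunk T-NT-EC). Pure proof file (no definition, no named
fact): two pieces of `2`-adic bookkeeping used by `TwistDuplicationDenominatorProofs.lean` (the
denominator half of the `x`-only duplication law for the minus-twist height; width seat
`bsd-line-cf2-p1-w5` g20, cell `bsd-print-cf2`, in support of stmt-BirchSwinnertonDyer-20368). BSD is not
proved by any of this.

* `norm_ratCast_den_eq` — **`‖den q‖_ℓ = min(1, ‖q‖_ℓ⁻¹)`** for a nonzero rational `q`;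
* `padicLog_two_pow` (`log₂ 2ⁿ = 0`), `padicLog_two_eq_of_norm_eq_odd` — **two nonzero rationals with
  the same `ℓ`-adic size at every ODD prime `ℓ` have the same Iwasawa `2`-adic logarithm** (their
  quotient is `±2^a/2^b`).

## Sources

* K. Iwasawa, *Lectures on p-adic L-functions* (1972), §4.4 (`log_p p = 0`, kernel of `log_p`).
  [Iwasawa1972PadicL]
* J. H. Silverman, *The Arithmetic of Elliptic Curves*, 2nd ed. (2009), VII.3.4 (denominators).
  [SilvermanAEC2009]
-/

noncomputable section

open scoped Classical
open Literature.NumberTheory.EllipticCurves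

namespace WeierstrassCurve

/-! ### §1 The `ℓ`-adic size of a denominator -/

section Den

variable (ℓ : ℕ) [Fact ℓ.Prime]

/-- **`‖den q‖_ℓ = min(1, ‖q‖_ℓ⁻¹)`** for a nonzero rational `q` (numerator and denominator are coprime).
[folklore] [cite: SilvermanAEC2009, VII.3.4] -/
theorem norm_ratCast_den_eq {q : ℚ} (hq : q ≠ 0) :
    ‖((q.den : ℚ) : ℚ_[ℓ])‖ = min 1 ‖(q : ℚ_[ℓ])‖⁻¹ := by
  have hℓ : ℓ.Prime := Fact.out
  have hden0 : ((q.den : ℚ) : ℚ_[ℓ]) ≠ 0 := by exact_mod_cast q.den_nz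
  have hq0 : (q : ℚ_[ℓ]) ≠ 0 := by exact_mod_cast hq
  have hqeq : (q : ℚ_[ℓ]) = ((q.num : ℚ) : ℚ_[ℓ]) / ((q.den : ℚ) : ℚ_[ℓ]) := by
    conv_lhs => rw [← Rat.num_div_den q]
    push_cast; rfl
  have hnum_le : ‖((q.num : ℚ) : ℚ_[ℓ])‖ ≤ 1 := by rw [Rat.cast_intCast]; exact Padic.norm_int_le_one _
  have hden_le : ‖((q.den : ℚ) : ℚ_[ℓ])‖ ≤ 1 := by
    rw [Rat.cast_natCast, ← Int.cast_natCast]; exact Padic.norm_int_le_one _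
  by_cases hdvd : ℓ ∣ q.den
  · -- `ℓ ∣ den`: the numerator is an `ℓ`-unit and `‖q‖ = 1/‖den‖ > 1`
    have hnum : ‖((q.num : ℚ) : ℚ_[ℓ])‖ = 1 := by
      refine le_antisymm hnum_le (not_lt.mp fun hlt => ?_)
      rw [Rat.cast_intCast, Padic.norm_intCast_lt_one_iff] at hlt
      exact not_dvd_num_of_dvd_den hℓ hdvd hlt
    have hden_lt : ‖((q.den : ℚ) : ℚ_[ℓ])‖ < 1 := by
      rw [Rat.cast_natCast, Padic.norm_natCast_lt_one_iff]; exact hdvd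
    rw [hqeq, norm_div, hnum, one_div, inv_inv, min_eq_right hden_lt.le]
  · -- `ℓ ∤ den`: `‖den‖ = 1` and `‖q‖ ≤ 1`
    have hden : ‖((q.den : ℚ) : ℚ_[ℓ])‖ = 1 := by
      refine le_antisymm hden_le (not_lt.mp fun hlt => hdvd ?_)
      rwa [Rat.cast_natCast, Padic.norm_natCast_lt_one_iff] at hlt
    have hq1 : ‖(q : ℚ_[ℓ])‖ ≤ 1 := Padic.norm_rat_le_one hdvd
    rw [hden, min_eq_left]
    exact one_le_inv_iff₀.mpr ⟨norm_pos_iff.mpr hq0, hq1⟩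

end Den

/-! ### §2 Rationals of the same size at every odd prime have the same `2`-adic logarithm -/

section OddPrimes

/-- `log₂ 2ⁿ = 0`. [cite: Iwasawa1972PadicL, §4.4] -/
theorem padicLog_two_pow (n : ℕ) : padicLog 2 ((2 : ℚ_[2]) ^ n) = 0 := by
  have hmul : padicLog_mul 2 := padicLog_mul_holds 2
  have h2 : padicLog 2 (2 : ℚ_[2]) = 0 := by exact_mod_cast padicLog_natCast_self_holds 2
  induction n with
  | zero => rw [pow_zero]; exact padicLog_one 2
  | succ n ih => rw [pow_succ, hmul (pow_ne_zero n two_ne_zero) two_ne_zero, ih, h2, add_zero]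

/-- A natural number prime to every odd prime is a power of `2` (private plumbing). [folklore] -/
private theorem eq_two_pow_of_forall_odd_prime_not_dvd {n : ℕ} (hn : n ≠ 0)
    (h : ∀ ℓ : ℕ, ℓ.Prime → ℓ ≠ 2 → ¬ ℓ ∣ n) : n = 2 ^ n.factorization 2 := by
  apply Nat.eq_pow_of_factorization_eq_single hn
  ext q
  by_cases hq2 : q = 2
  · subst hq2; simp
  · rw [Finsupp.single_eq_of_ne hq2]
    by_cases hq : q.Prime
    · exact Nat.factorization_eq_zero_of_not_dvd (h q hq hq2)
    · exact Nat.factorization_eq_zero_of_not_prime n hq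

/-- **Two nonzero rationals with the same `ℓ`-adic size at every ODD prime `ℓ` have the same `2`-adic
logarithm** — their quotient is `±2^a/2^b`, killed by `log₂` (`log₂ 2 = 0 = log₂(−1)`).
[cite: Iwasawa1972PadicL, §4.4] -/
theorem padicLog_two_eq_of_norm_eq_odd {r s : ℚ} (hr : r ≠ 0) (hs : s ≠ 0)
    (h : ∀ (ℓ : ℕ) [Fact ℓ.Prime], ℓ ≠ 2 → ‖(r : ℚ_[ℓ])‖ = ‖(s : ℚ_[ℓ])‖) :
    padicLog 2 (r : ℚ_[2]) = padicLog 2 (s : ℚ_[2]) := by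
  have hmul : padicLog_mul 2 := padicLog_mul_holds 2
  set t : ℚ := r / s with ht
  have ht0 : t ≠ 0 := div_ne_zero hr hs
  -- `t` is an `ℓ`-unit at every odd prime
  have hunit : ∀ (ℓ : ℕ), ℓ.Prime → ℓ ≠ 2 → ¬ ℓ ∣ t.num.natAbs ∧ ¬ ℓ ∣ t.den := by
    intro ℓ hℓ hℓ2
    haveI : Fact ℓ.Prime := ⟨hℓ⟩
    have hnt : ‖(t : ℚ_[ℓ])‖ = 1 := by
      rw [ht, Rat.cast_div, norm_div, h ℓ hℓ2, div_self]
      exact norm_ne_zero_iff.mpr (by exact_mod_cast hs)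
    have hv : padicValRat ℓ t = 0 := ((norm_ratCast_eq_one_iff ℓ t).mp hnt).2
    have hden : ¬ ℓ ∣ t.den := fun hd => by
      have hnum : padicValInt ℓ t.num = 0 :=
        padicValInt.eq_zero_of_not_dvd (not_dvd_num_of_dvd_den hℓ hd)
      have hvd : 0 < padicValNat ℓ t.den := one_le_padicValNat_of_dvd t.den_nz hd
      have : padicValRat ℓ t = (padicValInt ℓ t.num : ℤ) - (padicValNat ℓ t.den : ℤ) := rfl
      rw [hv, hnum] at this
      omega
    refine ⟨fun hn => ?_, hden⟩
    have hdv : padicValNat ℓ t.den = 0 := padicValNat.eq_zero_of_not_dvd hden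
    have : padicValRat ℓ t = (padicValInt ℓ t.num : ℤ) - (padicValNat ℓ t.den : ℤ) := rfl
    rw [hv, hdv] at this
    have hnum : padicValNat ℓ t.num.natAbs = 0 := by
      have h0 : padicValInt ℓ t.num = 0 := by omega
      simpa [padicValInt] using h0
    have hnum0 : t.num.natAbs ≠ 0 := Int.natAbs_ne_zero.mpr (Rat.num_ne_zero.mpr ht0)
    have := one_le_padicValNat_of_dvd hnum0 hn
    omega
  -- hence `|num t|` and `den t` are powers of `2`
  have hnum0 : t.num.natAbs ≠ 0 := Int.natAbs_ne_zero.mpr (Rat.num_ne_zero.mpr ht0)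
  have hN := eq_two_pow_of_forall_odd_prime_not_dvd hnum0 fun ℓ hℓ hℓ2 => (hunit ℓ hℓ hℓ2).1
  have hD := eq_two_pow_of_forall_odd_prime_not_dvd t.den_nz fun ℓ hℓ hℓ2 => (hunit ℓ hℓ hℓ2).2
  -- `log₂ t = 0`
  have hlogt : padicLog 2 (t : ℚ_[2]) = 0 := by
    have htq : (t : ℚ_[2]) = ((t.num : ℚ) : ℚ_[2]) / ((t.den : ℚ) : ℚ_[2]) := by
      conv_lhs => rw [← Rat.num_div_den t]
      push_cast; rfl
    have hpow0 : ∀ k : ℕ, ((2 : ℚ_[2]) ^ k) ≠ 0 := fun k => pow_ne_zero k two_ne_zero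
    have hnumlog : padicLog 2 ((t.num : ℚ) : ℚ_[2]) = 0 := by
      rw [Rat.cast_intCast]
      rcases Int.natAbs_eq t.num with h1 | h1 <;> rw [h1, hN]
      · push_cast; exact padicLog_two_pow _
      · push_cast; rw [padicLog_neg (hpow0 _)]; exact padicLog_two_pow _
    have hdenlog : padicLog 2 ((t.den : ℚ) : ℚ_[2]) = 0 := by
      rw [Rat.cast_natCast, hD]; push_cast; exact padicLog_two_pow _
    have hnum0' : ((t.num : ℚ) : ℚ_[2]) ≠ 0 := by exact_mod_cast Rat.num_ne_zero.mpr ht0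
    have hden0' : ((t.den : ℚ) : ℚ_[2]) ≠ 0 := by exact_mod_cast t.den_nz
    have := hmul hnum0' (inv_ne_zero hden0')
    rw [← div_eq_mul_inv, ← htq, hnumlog, zero_add] at this
    -- `log (den⁻¹) = -log den = 0`
    have hinv : padicLog 2 (((t.den : ℚ) : ℚ_[2]))⁻¹ = 0 := by
      have h' := hmul hden0' (inv_ne_zero hden0')
      rw [mul_inv_cancel₀ hden0', padicLog_one, hdenlog, zero_add] at h'
      exact h'.symm
    rw [this, hinv]
  have hrs : (r : ℚ_[2]) = (t : ℚ_[2]) * (s : ℚ_[2]) := by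
    rw [ht]; push_cast; field_simp
  rw [hrs, hmul (by exact_mod_cast ht0) (by exact_mod_cast hs), hlogt, zero_add]

end OddPrimes

end WeierstrassCurve
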